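import Literature.AlgebraicGeometry.Motives.JacobianGaloisDescent
import Literature.AlgebraicGeometry.Motives.BaseChangePointsProofs
import HarnessLib

/-!
# `Aut(ℂ/τL)` on the underlying space of `X ⊗_L ℂ`, compatibly with the left action on `X(ℂ)`

Topic `AlgebraicGeometry/Motives`, namespace `Literature.AlgebraicGeometry.Motives`. THEOREMS ONLY
(no definition, no named fact, no instance, no `sorry`).

For an `L`-scheme `X`, an embedding `τ : L →+* ℂ` (so that `ℂ` is an `L`-algebra via
`τ.toAlgebra`) and `σ ∈ Aut(ℂ/τL)`, the Galois automorphism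
`GaloisDescent.gal ℂ X σ = 1 × Spec σ⁻¹` of the complex fibre `X ⊗_L ℂ = X ×_L Spec ℂ`
(`Motives/JacobianGaloisDescent`, [Görtz–Wedhorn I, §(14.20)]) acts on the underlying Zariski space
of `X ⊗_L ℂ`; the tree's LEFT action `σ • P = Spec σ ≫ P` on complex points
(`AlgPoints.instMulActionAlgEquiv`) is transported to points of the complex fibre by
`AlgPoints.baseChangeEquiv τ X : X(ℂ) ≃ (X ⊗_L ℂ)(ℂ)` (`Motives/BaseChange`). The two are
compatible:

* `AlgPoints.baseChangeEquiv_left_comp_gal` (any field `L'` in place of `ℂ`) — on morphisms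
  `Spec L' ⟶ X ⊗_L L'`: `(P, 1) ≫ gal σ = Spec σ⁻¹ ≫ (σ • P, 1)`; for `L' = ℂ` this is
  `Literature.AlgebraicGeometry.ShimuraVarieties.UnitaryCanonicalModel.lift_comp_gal` in the
  `baseChangeEquiv` spelling (there `(P, 1)` is written as an explicit `pullback.lift`, identified
  with `(baseChangeEquiv τ X P).left` by `lift_eq_baseChangeEquiv_left`); re-proved here in a few
  lines over `Motives/JacobianGaloisDescent` so that this generic leaf imports `Motives/` only;
* `AlgPoints.pt_eq_left_base_closedPoint` — the underlying point of an `L'`-point is the image of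
  the closed point of `Spec L'` (definitional unfolding of `AlgPoints.pt`, recorded for rewriting);
* `AlgPoints.pt_baseChangeEquiv_smul` (any field `L'`) and **`pt_baseChangeEquiv_smul`** (`L' = ℂ`,
  leaf (G1) of the I-1′ programme, signature as registered by its planning workfile) — on
  underlying points: `pt (σ • P, 1) = (gal σ) (pt (P, 1))`, i.e. `Aut(L'/τL)` acts on the Zariski
  space of `X ⊗_L L'` through `gal`, compatibly with the left action on `X(L')` («the actions of
  `Aut(Ω/k)` on `V(Ω)`», [Milne2005ShimuraVarieties] Prop. 13.1 p. 117);
* `pt_baseChangeEquiv_smul_mem_iff` — corollary: `pt (σ • P, 1) ∈ Z ↔ pt (P, 1) ∈ (gal σ) ⁻¹ Z`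
  for any subset `Z` of the underlying space of `X ⊗_L ℂ`.

Used by the I-1′ line (canonical models of unitary Shimura varieties, stability of the image of a
closed immersion under `Aut(ℂ/E)`, `Cruxes/HDel/Lines/F1ExtHodgeType.lean` S5) and reusable by the
closure-descent step S3.

## References
* [GortzWedhorn2020] U. Görtz, T. Wedhorn, *Algebraic Geometry I*, §(14.20).
* [Milne2005ShimuraVarieties] J. S. Milne, *Introduction to Shimura varieties*, §13 Prop. 13.1
  p. 117.
-/

set_option autoImplicit false
set_option backward.isDefEq.respectTransparency false

noncomputable section

open CategoryTheory CategoryTheory.Limits AlgebraicGeometry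

namespace Literature.AlgebraicGeometry.Motives

universe u

/-! ### The underlying point of an `L'`-point -/

/-- The underlying point `P.pt` of an `L'`-point `P : Spec L' ⟶ X` is the image of the closed
(unique) point of `Spec L'` under the underlying continuous map (definitional unfolding of
`AlgPoints.pt` = first component of Mathlib `Scheme.SpecToEquivOfField`; Hartshorne II Ex. 2.7:
an `L'`-point of `X` is a point `x ∈ X` with an inclusion `κ(x) ⟶ L'`).
[cite: Hartshorne1977, II Ex. 2.7] -/
theorem AlgPoints.pt_eq_left_base_closedPoint {k : Type u} [Field k] {X : SchemeOver k}
    {L' : Type u} [Field L'] [Algebra k L'] (P : AlgPoints X L') :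
    P.pt = P.left.base (IsLocalRing.closedPoint L') := rfl

/-! ### `gal σ` and the left action on `L'`-points (any field `L'`) -/

section AnyField

variable {L L' : Type u} [Field L] [Field L'] (τ : L →+* L') (X : SchemeOver L)

/-- **`gal σ` moves `(P, 1)` to `(σ • P, 1)` up to `Spec σ⁻¹` on the source**: for a field
extension `τ : L →+* L'`, `σ ∈ Aut(L'/τL)` and an `L'`-point `P ∈ X(L')` along `τ`,
`(baseChangeEquiv τ X P).left ≫ gal σ = Spec σ⁻¹ ≫ (baseChangeEquiv τ X (σ • P)).left`
as morphisms `Spec L' ⟶ X ×_L Spec L'` (check on the two projections: `gal_fst`/`gal_snd`,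
`baseChangeEquiv_apply_left_comp_fst/snd`, `AlgPoints.smul_left`). For `L' = ℂ` this is
`…ShimuraVarieties.UnitaryCanonicalModel.lift_comp_gal` in `baseChangeEquiv` spelling.
[cite: Milne2005ShimuraVarieties, §13 Prop. 13.1 p. 117 («the actions of Aut(Ω/k) on V(Ω)»)] -/
theorem AlgPoints.baseChangeEquiv_left_comp_gal (σ : letI := τ.toAlgebra; L' ≃ₐ[L] L')
    (P : letI := τ.toAlgebra; AlgPoints X L') :
    letI := τ.toAlgebra
    (AlgPoints.baseChangeEquiv τ X P).left ≫ GaloisDescent.gal L' X σ =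
      AbelianVariety.specAut L' σ⁻¹ ≫ (AlgPoints.baseChangeEquiv τ X (σ • P)).left := by
  letI := τ.toAlgebra
  apply pullback.hom_ext
  · simp only [Category.assoc]
    erw [GaloisDescent.gal_fst, AlgPoints.baseChangeEquiv_apply_left_comp_fst τ X P,
      AlgPoints.baseChangeEquiv_apply_left_comp_fst τ X (σ • P)]
    rw [AlgPoints.smul_left, ← Category.assoc]
    erw [AbelianVariety.specAut_symm_comp_specAut (L := L') (σ := σ)]
    exact (Category.id_comp _).symm
  · simp only [Category.assoc]
    erw [GaloisDescent.gal_snd]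
    rw [← Category.assoc]
    erw [AlgPoints.baseChangeEquiv_apply_left_comp_snd τ X P,
      AlgPoints.baseChangeEquiv_apply_left_comp_snd τ X (σ • P)]
    rw [Algebra.algebraMap_self, CommRingCat.ofHom_id]
    erw [Spec.map_id]
    exact (Category.id_comp _).trans (Category.comp_id _).symm

/-- **`Aut(L'/τL)` acts on the underlying space of `X ⊗_L L'` through `gal σ = 1 × Spec σ⁻¹`,
compatibly with the LEFT action on `X(L')`** (any field `L'`): the underlying point of
`(σ • P, 1) ∈ (X ⊗_L L')(L')` is the image under `gal σ` of the underlying point of `(P, 1)`.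
(Apply `.base` to `baseChangeEquiv_left_comp_gal` at the closed point of `Spec L'`; `Spec σ⁻¹`
fixes that point since `Spec L'` has one point.)
[cite: Milne2005ShimuraVarieties, §13 Prop. 13.1 p. 117 («the actions of Aut(Ω/k) on V(Ω)»)] -/
theorem AlgPoints.pt_baseChangeEquiv_smul (σ : letI := τ.toAlgebra; L' ≃ₐ[L] L')
    (P : letI := τ.toAlgebra; AlgPoints X L') :
    letI := τ.toAlgebra;
    (AlgPoints.baseChangeEquiv τ X (σ • P)).pt =
      (GaloisDescent.gal L' X σ).base ((AlgPoints.baseChangeEquiv τ X P).pt) := by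
  letI := τ.toAlgebra
  have h := AlgPoints.baseChangeEquiv_left_comp_gal τ X σ P
  have hcp : (AbelianVariety.specAut L' σ⁻¹).base (IsLocalRing.closedPoint L') =
      IsLocalRing.closedPoint L' :=
    Subsingleton.elim _ _
  rw [AlgPoints.pt_eq_left_base_closedPoint, AlgPoints.pt_eq_left_base_closedPoint]
  calc (AlgPoints.baseChangeEquiv τ X (σ • P)).left.base (IsLocalRing.closedPoint L')
      = (AlgPoints.baseChangeEquiv τ X (σ • P)).left.base
          ((AbelianVariety.specAut L' σ⁻¹).base (IsLocalRing.closedPoint L')) :=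
        congrArg _ hcp.symm
    _ = (AbelianVariety.specAut L' σ⁻¹ ≫ (AlgPoints.baseChangeEquiv τ X (σ • P)).left).base
          (IsLocalRing.closedPoint L') := (Scheme.Hom.comp_apply _ _ _).symm
    _ = ((AlgPoints.baseChangeEquiv τ X P).left ≫ GaloisDescent.gal L' X σ).base
          (IsLocalRing.closedPoint L') :=
        congrArg (fun f => f.base (IsLocalRing.closedPoint L')) h.symm
    _ = (GaloisDescent.gal L' X σ).base
          ((AlgPoints.baseChangeEquiv τ X P).left.base (IsLocalRing.closedPoint L')) :=
        Scheme.Hom.comp_apply _ _ _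

end AnyField

/-! ### Complex points: the I-1′ leaf (G1) -/

/-- **(G1) `Aut(ℂ/τL)` acts on the underlying Zariski space of `X ⊗_L ℂ` through
`gal σ = 1 × Spec σ⁻¹`, compatibly with the LEFT action on `X(ℂ)`.** For `σ ∈ Aut(ℂ/τL)` and
`P ∈ X(ℂ)` (along `τ`), the underlying point of `(σ • P, 1) ∈ (X ⊗_L ℂ)(ℂ)` is the image under
`gal σ` of the underlying point of `(P, 1)`:
`(baseChangeEquiv τ X (σ • P)).pt = (gal σ).base ((baseChangeEquiv τ X P).pt)`
(the case `L' = ℂ` of `AlgPoints.pt_baseChangeEquiv_smul`). Consumers instantiate `L := ↥E`,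
`τ := algebraMap ↥E ℂ` (`pointsOfForm`).
[cite: Milne2005ShimuraVarieties, §13 Prop. 13.1 p. 117 («the actions of Aut(Ω/k) on V(Ω)»)] -/
theorem pt_baseChangeEquiv_smul {L : Type} [Field L] (τ : L →+* ℂ) (X : SchemeOver L)
    (σ : letI := τ.toAlgebra; ℂ ≃ₐ[L] ℂ) (P : letI := τ.toAlgebra; ComplexPoints X) :
    letI := τ.toAlgebra
    (AlgPoints.baseChangeEquiv τ X (σ • P)).pt =
      (GaloisDescent.gal ℂ X σ).base ((AlgPoints.baseChangeEquiv τ X P).pt) :=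
  AlgPoints.pt_baseChangeEquiv_smul τ X σ P

/-- Corollary of `pt_baseChangeEquiv_smul` for membership in a subset `Z` of the underlying space
of `X ⊗_L ℂ`: `pt (σ • P, 1) ∈ Z ↔ pt (P, 1) ∈ (gal σ) ⁻¹ Z`.
[cite: Milne2005ShimuraVarieties, §13 Prop. 13.1 p. 117] -/
theorem pt_baseChangeEquiv_smul_mem_iff {L : Type} [Field L] (τ : L →+* ℂ) (X : SchemeOver L)
    (σ : letI := τ.toAlgebra; ℂ ≃ₐ[L] ℂ) (P : letI := τ.toAlgebra; ComplexPoints X)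
    (Z : Set ↥((baseChangeHom τ).obj X).left) :
    letI := τ.toAlgebra;
    (AlgPoints.baseChangeEquiv τ X (σ • P)).pt ∈ Z ↔
      (AlgPoints.baseChangeEquiv τ X P).pt ∈ (GaloisDescent.gal ℂ X σ).base ⁻¹' Z := by
  letI := τ.toAlgebra
  rw [pt_baseChangeEquiv_smul, Set.mem_preimage]

end Literature.AlgebraicGeometry.Motives

end
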